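import Summits.KontsevichZagierPeriods.Zeta5Search.Barrier.ConeGammaLemmaF
import Summits.KontsevichZagierPeriods.Zeta5Search.Barrier.ConeGammaSepMajorant
import Summits.KontsevichZagierPeriods.Zeta5Search.Barrier.ConeGammaRates

/-!
# ζ(5) search — BARRIER: LEMMA F for the two separable majorants of record (F7, F6) — closed-form bounds for `Φ`

HONEST FRAMING (cell `pub-zeta5`): systematic search; no irrationality claim unless kernel-certified. MODEL objects
under Brown–Zudilin's (28)+(30) accounting ([BZ22] = arXiv:2210.03391; (28) observed, not proved): explicit elementary
UPPER BOUNDS for BZ's MODEL saving rate `Φ = phi30`, valid at every REAL direction of the stated chambers of the closed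
box (no period, no rationality), obtained from cert-2 g32/g33's integer separable majorants F7 / F6 of the saving step
function (`torusN_le_F7`, `torusN_le_F6`, tree `ConeGammaSepMajorant`) by LEMMA F (`phi30_le_of_sepBound`, file 1/2
`ConeGammaLemmaF`). An upper bound for `Φ` enters `γ` only through the memo's MODEL ceiling
`γ_maj = (C₁ − C₀)/(C₁ + δ₂₈ − Φ_maj)` with `C₀, C₁` of record (DATA tier, not in the kernel); nothing here is about the
cone's supremum (C2 OPEN), S-E (CONJECTURED) or `ζ(5)`; no number or sentence of record moves; records in print UNMOVED.
Prover P2 g24 (item «LEMMA F IN THE KERNEL», cert-2 g33's menu (d); memo `cert-2/g32/SEP-MAJORANT.md` §0 (R2)/(R3)),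
file 2/2.

With `s = (s₀; s₁,…,s₇)` the symmetric parameters and `g_H(x) := x·log(H/x)`:

* **`phi30_aOfS_le_boundF7`** — if `0 ≤ s_j ≤ s₀` (closed box) and `s₂,…,s₆ ≤ s₇`, then with `H = s₀ + s₇`
  `Φ ≤ H + Σ_{F7's 18 features} ε_m g_H(x_m)` (the features and signs of `torusN_le_F7` term by term: `+`:
  `s₀+s₇, s₁+s₆, s₃+s₅, s₄+s₅, s₄+s₆, s₀−s₇, s₇−s₂, …, s₇−s₆`; `−`: `s₁+s₇, s₃+s₇, s₄+s₇, s₅+s₇, s₆+s₇, s₀−s₂, s₀−s₃`);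
* **`phi30_aOfS_le_boundF6`** — if `0 ≤ s_j ≤ s₀` and `s₁,…,s₅ ≤ s₆`, then with `H = s₀ + s₆`
  `Φ ≤ H + Σ_{F6's 17 features} ε_m g_H(x_m)` (`−2` on `s₆+s₇`);
* `phi30_le_boundF7`, `phi30_le_boundF6` — the same for a direction `a` (`s = sParam a`);
* `gamma_le_of_phi30_le`, `extraSaving_pos_of_phi30_le`, `gamma_lt_one_of_phi30_le` — what ANY bound `Φ(a) ≤ B` gives
  for the MODEL rate: the memo's ceiling `γ ≤ γ_maj = (C₁−C₀)/(C₁+δ₂₈−B)` and «ALIVE»: `B + |C₀| < δ₂₈ ⇒ S* > 0`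
  (`⇒ γ < 1` under the sign conditions of `gamma_lt_one_iff`) — three-line monotonicity facts; the values of `C₀, C₁`
  at any named direction stay DATA unless pinned in the tree.
Both chambers contain the closed SORTED chamber `s₁ ≤ ⋯ ≤ s₇` of the memo. In the memo's units (`s₀ = 1`, `t = s/s₀`)
these are EXACTLY cert-2 g32's `B_F7(t)`, `B_F6(t)` of §0 (R2) (the constant `1 − γ_E` of `λ(L)` cancels because the
linear parts of F7 / F6 cancel; the one feature with `u₀x > 1` accounts for `H = 1 + t₇` resp. `1 + t₆` in place of
`1/u₀`): e.g. `B_F7 = 2.2479005133…`, `B_F6 = 2.2615060512…` at BZ's record ray `(41; 7,…,19)` and `0.4091370926…` at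
the symmetric ray — evaluations of the closed form (seat file `alg/bcheck.py`), DATA tier, not kernel statements.
-/

noncomputable section

open Set MeasureTheory

namespace Summit.KontsevichZagierPeriods.Zeta5Search.Barrier.ConeGamma

/-! ### F7 -/

/-- **LEMMA F for F7 (symmetric parameters).** On the closed box with `s₂,…,s₆ ≤ s₇`, with `H = s₀ + s₇`:
`Φ(aOfS s) ≤ H + Σ_m ε_m x_m log(H/x_m)` over the 18 features of `torusN_le_F7` (the first term,
`(s₀+s₇)·log 1`, vanishes; it is kept for the term-by-term correspondence). -/
theorem phi30_aOfS_le_boundF7 (s : Fin 8 → ℝ) (h0 : 0 < s 0) (hlo : ∀ j : Fin 7, 0 ≤ s j.succ)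
    (hhi : ∀ j : Fin 7, s j.succ ≤ s 0) (h2 : s 2 ≤ s 7) (h3 : s 3 ≤ s 7) (h4 : s 4 ≤ s 7) (h5 : s 5 ≤ s 7)
    (h6 : s 6 ≤ s 7) :
    phi30 (aOfS s) ≤ (s 0 + s 7)
      + (s 0 + s 7) * Real.log ((s 0 + s 7) / (s 0 + s 7)) + (s 1 + s 6) * Real.log ((s 0 + s 7) / (s 1 + s 6))
      + (s 3 + s 5) * Real.log ((s 0 + s 7) / (s 3 + s 5)) + (s 4 + s 5) * Real.log ((s 0 + s 7) / (s 4 + s 5))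
      + (s 4 + s 6) * Real.log ((s 0 + s 7) / (s 4 + s 6)) + (s 0 - s 7) * Real.log ((s 0 + s 7) / (s 0 - s 7))
      + (s 7 - s 2) * Real.log ((s 0 + s 7) / (s 7 - s 2)) + (s 7 - s 3) * Real.log ((s 0 + s 7) / (s 7 - s 3))
      + (s 7 - s 4) * Real.log ((s 0 + s 7) / (s 7 - s 4)) + (s 7 - s 5) * Real.log ((s 0 + s 7) / (s 7 - s 5))
      + (s 7 - s 6) * Real.log ((s 0 + s 7) / (s 7 - s 6))
      - (s 1 + s 7) * Real.log ((s 0 + s 7) / (s 1 + s 7)) - (s 3 + s 7) * Real.log ((s 0 + s 7) / (s 3 + s 7))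
      - (s 4 + s 7) * Real.log ((s 0 + s 7) / (s 4 + s 7)) - (s 5 + s 7) * Real.log ((s 0 + s 7) / (s 5 + s 7))
      - (s 6 + s 7) * Real.log ((s 0 + s 7) / (s 6 + s 7)) - (s 0 - s 2) * Real.log ((s 0 + s 7) / (s 0 - s 2))
      - (s 0 - s 3) * Real.log ((s 0 + s 7) / (s 0 - s 3)) := by
  have h1lo := hlo 0; have h2lo := hlo 1; have h3lo := hlo 2; have h4lo := hlo 3; have h5lo := hlo 4
  have h6lo := hlo 5; have h7lo := hlo 6
  have h1hi := hhi 0; have h2hi := hhi 1; have h3hi := hhi 2; have h4hi := hhi 3; have h5hi := hhi 4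
  have h6hi := hhi 5; have h7hi := hhi 6
  simp only [Fin.succ_zero_eq_one, Fin.succ_one_eq_two] at h1lo h2lo h1hi h2hi
  change 0 ≤ s 3 at h3lo; change 0 ≤ s 4 at h4lo; change 0 ≤ s 5 at h5lo; change 0 ≤ s 6 at h6lo
  change 0 ≤ s 7 at h7lo
  change s 3 ≤ s 0 at h3hi; change s 4 ≤ s 0 at h4hi; change s 5 ≤ s 0 at h5hi; change s 6 ≤ s 0 at h6hi
  change s 7 ≤ s 0 at h7hi
  have hbox : BZBox (aOfS s) := by
    refine ⟨by rwa [sParam_aOfS], fun j => ⟨by rw [sParam_aOfS]; exact hlo j, by rw [sParam_aOfS]; exact hhi j⟩⟩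
  set H : ℝ := s 0 + s 7 with hHdef
  have hH : 0 < H := by rw [hHdef]; linarith
  -- the 18 features of F7 and their signs
  set x : Fin 18 → ℝ := ![s 0 + s 7, s 1 + s 6, s 3 + s 5, s 4 + s 5, s 4 + s 6, s 0 - s 7, s 7 - s 2, s 7 - s 3,
    s 7 - s 4, s 7 - s 5, s 7 - s 6, s 1 + s 7, s 3 + s 7, s 4 + s 7, s 5 + s 7, s 6 + s 7, s 0 - s 2, s 0 - s 3]
    with hx
  set ε : Fin 18 → ℝ := ![1, 1, 1, 1, 1, 1, 1, 1, 1, 1, 1, -1, -1, -1, -1, -1, -1, -1] with hε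
  have hh : ∀ k : Fin 28, h28 (aOfS s) k ≤ H := by
    intro k
    rw [h28_aOfS, hHdef]
    fin_cases k <;> simp <;> linarith
  have hx0 : ∀ m ∈ (Finset.univ : Finset (Fin 18)), 0 ≤ x m := by
    intro m _
    fin_cases m <;> simp [hx] <;> linarith
  have hxH : ∀ m ∈ (Finset.univ : Finset (Fin 18)), x m ≤ H := by
    intro m _
    rw [hHdef]
    fin_cases m <;> simp [hx] <;> linarith
  have hlin : ∑ m ∈ (Finset.univ : Finset (Fin 18)), ε m * x m = 0 := by
    simp only [Fin.sum_univ_succ, Fin.sum_univ_zero, hx, hε, Matrix.cons_val_zero, Matrix.cons_val_succ]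
    ring
  have hN : ∀ u : ℝ, 1 / H ≤ u →
      (savingN (aOfS s) u : ℝ) ≤ 1 + ∑ m ∈ (Finset.univ : Finset (Fin 18)), ε m * Int.fract (u * x m) := by
    intro u _
    rw [savingN_eq_torusN_of_BZBox hbox, sParam_aOfS]
    have hF := torusN_le_F7 (u • s)
    simp only [Pi.smul_apply, smul_eq_mul, ← mul_add, ← mul_sub] at hF
    simp only [Fin.sum_univ_succ, Fin.sum_univ_zero, hx, hε, Matrix.cons_val_zero, Matrix.cons_val_succ]
    linarith
  have key := phi30_le_of_sepBound hbox hH hh Finset.univ ε x 1 hx0 hxH hlin hN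
  simp only [Fin.sum_univ_succ, Fin.sum_univ_zero, hx, hε, Matrix.cons_val_zero, Matrix.cons_val_succ,
    one_mul] at key
  rw [hHdef] at key
  linarith

/-- **LEMMA F for F7 (directions).** For `a` in the closed box with `s₂,…,s₆ ≤ s₇` (`s = sParam a`; in particular on
the closed sorted chamber): `Φ(a) ≤ (s₀+s₇) + Σ_m ε_m x_m log((s₀+s₇)/x_m)` over F7's 18 features. -/
theorem phi30_le_boundF7 {a : Dir} (ha : BZBox a) (h2 : sParam a 2 ≤ sParam a 7) (h3 : sParam a 3 ≤ sParam a 7)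
    (h4 : sParam a 4 ≤ sParam a 7) (h5 : sParam a 5 ≤ sParam a 7) (h6 : sParam a 6 ≤ sParam a 7) :
    phi30 a ≤ (sParam a 0 + sParam a 7)
      + (sParam a 0 + sParam a 7) * Real.log ((sParam a 0 + sParam a 7) / (sParam a 0 + sParam a 7))
      + (sParam a 1 + sParam a 6) * Real.log ((sParam a 0 + sParam a 7) / (sParam a 1 + sParam a 6))
      + (sParam a 3 + sParam a 5) * Real.log ((sParam a 0 + sParam a 7) / (sParam a 3 + sParam a 5))
      + (sParam a 4 + sParam a 5) * Real.log ((sParam a 0 + sParam a 7) / (sParam a 4 + sParam a 5))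
      + (sParam a 4 + sParam a 6) * Real.log ((sParam a 0 + sParam a 7) / (sParam a 4 + sParam a 6))
      + (sParam a 0 - sParam a 7) * Real.log ((sParam a 0 + sParam a 7) / (sParam a 0 - sParam a 7))
      + (sParam a 7 - sParam a 2) * Real.log ((sParam a 0 + sParam a 7) / (sParam a 7 - sParam a 2))
      + (sParam a 7 - sParam a 3) * Real.log ((sParam a 0 + sParam a 7) / (sParam a 7 - sParam a 3))
      + (sParam a 7 - sParam a 4) * Real.log ((sParam a 0 + sParam a 7) / (sParam a 7 - sParam a 4))
      + (sParam a 7 - sParam a 5) * Real.log ((sParam a 0 + sParam a 7) / (sParam a 7 - sParam a 5))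
      + (sParam a 7 - sParam a 6) * Real.log ((sParam a 0 + sParam a 7) / (sParam a 7 - sParam a 6))
      - (sParam a 1 + sParam a 7) * Real.log ((sParam a 0 + sParam a 7) / (sParam a 1 + sParam a 7))
      - (sParam a 3 + sParam a 7) * Real.log ((sParam a 0 + sParam a 7) / (sParam a 3 + sParam a 7))
      - (sParam a 4 + sParam a 7) * Real.log ((sParam a 0 + sParam a 7) / (sParam a 4 + sParam a 7))
      - (sParam a 5 + sParam a 7) * Real.log ((sParam a 0 + sParam a 7) / (sParam a 5 + sParam a 7))
      - (sParam a 6 + sParam a 7) * Real.log ((sParam a 0 + sParam a 7) / (sParam a 6 + sParam a 7))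
      - (sParam a 0 - sParam a 2) * Real.log ((sParam a 0 + sParam a 7) / (sParam a 0 - sParam a 2))
      - (sParam a 0 - sParam a 3) * Real.log ((sParam a 0 + sParam a 7) / (sParam a 0 - sParam a 3)) := by
  have h := phi30_aOfS_le_boundF7 (sParam a) ha.1 (fun j => (ha.2 j).1) (fun j => (ha.2 j).2) h2 h3 h4 h5 h6
  rwa [aOfS_sParam] at h

/-! ### F6 -/

/-- **LEMMA F for F6 (symmetric parameters).** On the closed box with `s₁,…,s₅ ≤ s₆`, with `H = s₀ + s₆`:
`Φ(aOfS s) ≤ H + Σ_m ε_m x_m log(H/x_m)` over the 17 features of `torusN_le_F6` (`−2` on `s₆+s₇`). -/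
theorem phi30_aOfS_le_boundF6 (s : Fin 8 → ℝ) (h0 : 0 < s 0) (hlo : ∀ j : Fin 7, 0 ≤ s j.succ)
    (hhi : ∀ j : Fin 7, s j.succ ≤ s 0) (h1 : s 1 ≤ s 6) (h2 : s 2 ≤ s 6) (h3 : s 3 ≤ s 6) (h4 : s 4 ≤ s 6)
    (h5 : s 5 ≤ s 6) :
    phi30 (aOfS s) ≤ (s 0 + s 6)
      + (s 0 + s 6) * Real.log ((s 0 + s 6) / (s 0 + s 6)) + (s 1 + s 7) * Real.log ((s 0 + s 6) / (s 1 + s 7))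
      + (s 2 + s 7) * Real.log ((s 0 + s 6) / (s 2 + s 7)) + (s 3 + s 5) * Real.log ((s 0 + s 6) / (s 3 + s 5))
      + (s 4 + s 5) * Real.log ((s 0 + s 6) / (s 4 + s 5)) + (s 0 - s 6) * Real.log ((s 0 + s 6) / (s 0 - s 6))
      + (s 6 - s 1) * Real.log ((s 0 + s 6) / (s 6 - s 1)) + (s 6 - s 2) * Real.log ((s 0 + s 6) / (s 6 - s 2))
      + (s 6 - s 3) * Real.log ((s 0 + s 6) / (s 6 - s 3)) + (s 6 - s 4) * Real.log ((s 0 + s 6) / (s 6 - s 4))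
      + (s 6 - s 5) * Real.log ((s 0 + s 6) / (s 6 - s 5))
      - (s 2 + s 6) * Real.log ((s 0 + s 6) / (s 2 + s 6)) - (s 3 + s 6) * Real.log ((s 0 + s 6) / (s 3 + s 6))
      - (s 5 + s 6) * Real.log ((s 0 + s 6) / (s 5 + s 6)) - 2 * ((s 6 + s 7) * Real.log ((s 0 + s 6) / (s 6 + s 7)))
      - (s 0 - s 2) * Real.log ((s 0 + s 6) / (s 0 - s 2)) - (s 0 - s 3) * Real.log ((s 0 + s 6) / (s 0 - s 3)) := by
  have h1lo := hlo 0; have h2lo := hlo 1; have h3lo := hlo 2; have h4lo := hlo 3; have h5lo := hlo 4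
  have h6lo := hlo 5; have h7lo := hlo 6
  have h1hi := hhi 0; have h2hi := hhi 1; have h3hi := hhi 2; have h4hi := hhi 3; have h5hi := hhi 4
  have h6hi := hhi 5; have h7hi := hhi 6
  simp only [Fin.succ_zero_eq_one, Fin.succ_one_eq_two] at h1lo h2lo h1hi h2hi
  change 0 ≤ s 3 at h3lo; change 0 ≤ s 4 at h4lo; change 0 ≤ s 5 at h5lo; change 0 ≤ s 6 at h6lo
  change 0 ≤ s 7 at h7lo
  change s 3 ≤ s 0 at h3hi; change s 4 ≤ s 0 at h4hi; change s 5 ≤ s 0 at h5hi; change s 6 ≤ s 0 at h6hi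
  change s 7 ≤ s 0 at h7hi
  have hbox : BZBox (aOfS s) := by
    refine ⟨by rwa [sParam_aOfS], fun j => ⟨by rw [sParam_aOfS]; exact hlo j, by rw [sParam_aOfS]; exact hhi j⟩⟩
  set H : ℝ := s 0 + s 6 with hHdef
  have hH : 0 < H := by rw [hHdef]; linarith
  -- the 17 features of F6 and their signs
  set x : Fin 17 → ℝ := ![s 0 + s 6, s 1 + s 7, s 2 + s 7, s 3 + s 5, s 4 + s 5, s 0 - s 6, s 6 - s 1, s 6 - s 2,
    s 6 - s 3, s 6 - s 4, s 6 - s 5, s 2 + s 6, s 3 + s 6, s 5 + s 6, s 6 + s 7, s 0 - s 2, s 0 - s 3] with hx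
  set ε : Fin 17 → ℝ := ![1, 1, 1, 1, 1, 1, 1, 1, 1, 1, 1, -1, -1, -1, -2, -1, -1] with hε
  have hh : ∀ k : Fin 28, h28 (aOfS s) k ≤ H := by
    intro k
    rw [h28_aOfS, hHdef]
    fin_cases k <;> simp <;> linarith
  have hx0 : ∀ m ∈ (Finset.univ : Finset (Fin 17)), 0 ≤ x m := by
    intro m _
    fin_cases m <;> simp [hx] <;> linarith
  have hxH : ∀ m ∈ (Finset.univ : Finset (Fin 17)), x m ≤ H := by
    intro m _
    rw [hHdef]
    fin_cases m <;> simp [hx] <;> linarith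
  have hlin : ∑ m ∈ (Finset.univ : Finset (Fin 17)), ε m * x m = 0 := by
    simp only [Fin.sum_univ_succ, Fin.sum_univ_zero, hx, hε, Matrix.cons_val_zero, Matrix.cons_val_succ]
    ring
  have hN : ∀ u : ℝ, 1 / H ≤ u →
      (savingN (aOfS s) u : ℝ) ≤ 1 + ∑ m ∈ (Finset.univ : Finset (Fin 17)), ε m * Int.fract (u * x m) := by
    intro u _
    rw [savingN_eq_torusN_of_BZBox hbox, sParam_aOfS]
    have hF := torusN_le_F6 (u • s)
    simp only [Pi.smul_apply, smul_eq_mul, ← mul_add, ← mul_sub] at hF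
    simp only [Fin.sum_univ_succ, Fin.sum_univ_zero, hx, hε, Matrix.cons_val_zero, Matrix.cons_val_succ]
    linarith
  have key := phi30_le_of_sepBound hbox hH hh Finset.univ ε x 1 hx0 hxH hlin hN
  simp only [Fin.sum_univ_succ, Fin.sum_univ_zero, hx, hε, Matrix.cons_val_zero, Matrix.cons_val_succ,
    one_mul] at key
  rw [hHdef] at key
  linarith

/-- **LEMMA F for F6 (directions).** For `a` in the closed box with `s₁,…,s₅ ≤ s₆` (`s = sParam a`; in particular on
the closed sorted chamber): `Φ(a) ≤ (s₀+s₆) + Σ_m ε_m x_m log((s₀+s₆)/x_m)` over F6's 17 features. -/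
theorem phi30_le_boundF6 {a : Dir} (ha : BZBox a) (h1 : sParam a 1 ≤ sParam a 6) (h2 : sParam a 2 ≤ sParam a 6)
    (h3 : sParam a 3 ≤ sParam a 6) (h4 : sParam a 4 ≤ sParam a 6) (h5 : sParam a 5 ≤ sParam a 6) :
    phi30 a ≤ (sParam a 0 + sParam a 6)
      + (sParam a 0 + sParam a 6) * Real.log ((sParam a 0 + sParam a 6) / (sParam a 0 + sParam a 6))
      + (sParam a 1 + sParam a 7) * Real.log ((sParam a 0 + sParam a 6) / (sParam a 1 + sParam a 7))
      + (sParam a 2 + sParam a 7) * Real.log ((sParam a 0 + sParam a 6) / (sParam a 2 + sParam a 7))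
      + (sParam a 3 + sParam a 5) * Real.log ((sParam a 0 + sParam a 6) / (sParam a 3 + sParam a 5))
      + (sParam a 4 + sParam a 5) * Real.log ((sParam a 0 + sParam a 6) / (sParam a 4 + sParam a 5))
      + (sParam a 0 - sParam a 6) * Real.log ((sParam a 0 + sParam a 6) / (sParam a 0 - sParam a 6))
      + (sParam a 6 - sParam a 1) * Real.log ((sParam a 0 + sParam a 6) / (sParam a 6 - sParam a 1))
      + (sParam a 6 - sParam a 2) * Real.log ((sParam a 0 + sParam a 6) / (sParam a 6 - sParam a 2))
      + (sParam a 6 - sParam a 3) * Real.log ((sParam a 0 + sParam a 6) / (sParam a 6 - sParam a 3))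
      + (sParam a 6 - sParam a 4) * Real.log ((sParam a 0 + sParam a 6) / (sParam a 6 - sParam a 4))
      + (sParam a 6 - sParam a 5) * Real.log ((sParam a 0 + sParam a 6) / (sParam a 6 - sParam a 5))
      - (sParam a 2 + sParam a 6) * Real.log ((sParam a 0 + sParam a 6) / (sParam a 2 + sParam a 6))
      - (sParam a 3 + sParam a 6) * Real.log ((sParam a 0 + sParam a 6) / (sParam a 3 + sParam a 6))
      - (sParam a 5 + sParam a 6) * Real.log ((sParam a 0 + sParam a 6) / (sParam a 5 + sParam a 6))
      - 2 * ((sParam a 6 + sParam a 7) * Real.log ((sParam a 0 + sParam a 6) / (sParam a 6 + sParam a 7)))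
      - (sParam a 0 - sParam a 2) * Real.log ((sParam a 0 + sParam a 6) / (sParam a 0 - sParam a 2))
      - (sParam a 0 - sParam a 3) * Real.log ((sParam a 0 + sParam a 6) / (sParam a 0 - sParam a 3)) := by
  have h := phi30_aOfS_le_boundF6 (sParam a) ha.1 (fun j => (ha.2 j).1) (fun j => (ha.2 j).2) h1 h2 h3 h4 h5
  rwa [aOfS_sParam] at h

/-! ### What a bound `Φ ≤ B` gives for the MODEL rate `γ` (the memo's `γ_maj` and «ALIVE» columns) -/

/-- **The memo's ceiling `γ_maj`.** If `Φ(a) ≤ B`, `C₀(a) ≤ C₁(a)` and `C₁(a) + δ₂₈(a) − B > 0`, then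
`γ(a) ≤ (C₁ − C₀)/(C₁ + δ₂₈ − B)` (`γ` is increasing in `Φ`). -/
theorem gamma_le_of_phi30_le {a : Dir} {B : ℝ} (hΦ : phi30 a ≤ B) (h01 : C0 a ≤ C1 a)
    (hden : 0 < C1 a + delta28 a - B) :
    gamma a ≤ (C1 a - C0 a) / (C1 a + delta28 a - B) := by
  unfold gamma
  exact div_le_div_of_nonneg_left (by linarith) hden (by linarith)

/-- **«ALIVE».** If `Φ(a) ≤ B` and `B + |C₀(a)| < δ₂₈(a)`, the extra saving `S*(a) = δ₂₈ − Φ − |C₀|` is positive. -/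
theorem extraSaving_pos_of_phi30_le {a : Dir} {B : ℝ} (hΦ : phi30 a ≤ B) (hB : B + |C0 a| < delta28 a) :
    0 < extraSaving a := by
  unfold extraSaving
  linarith

/-- … and then `γ(a) < 1`, given the signs `C₀(a) < 0 ≤ C₁(a)` (via the tree's `gamma_lt_one_iff`). -/
theorem gamma_lt_one_of_phi30_le {a : Dir} {B : ℝ} (hΦ : phi30 a ≤ B) (hB : B + |C0 a| < delta28 a)
    (hC0 : C0 a < 0) (hC1 : 0 ≤ C1 a) : gamma a < 1 := by
  have hQ : 0 < C1 a + delta28 a - phi30 a := by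
    have := abs_nonneg (C0 a)
    linarith
  exact (gamma_lt_one_iff hC0 hQ).mpr (extraSaving_pos_of_phi30_le hΦ hB)

end Summit.KontsevichZagierPeriods.Zeta5Search.Barrier.ConeGamma

end
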